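import Mathlib
import Summits.ValiantsHypothesis.ValiantsHypothesis.Theorems.FifoMatchingNNDivisionHardTorusHomogeneous
import Summits.ValiantsHypothesis.ValiantsHypothesis.Theorems.FifoMatchingNNDivisionHardFewVerticesCofactor
import Summits.ValiantsHypothesis.ValiantsHypothesis.Theses.FifoMatching
import Literature.Computability.AlgebraicComplexity.NestFreeMatchingPoly
import HarnessLib

/-!
# Route FifoMatching — crux `NNDivisionHard` (stmt-ValiantsHypothesis-21181):
# the residual in ONE statement — cheap, torus-homogeneous, hyper-degree AND spread cofactors

Combines the three landed localisations of what is OPEN in 21181 into one tier, by name: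
`HyperDegree.nnDivisionHard_iff_hyperDegree` (total degree `> 2^⌊n^{1/8}⌋`, via `GridCorShadow.expRung_holds`),
`TorusHomogeneous.nnDivisionHard_iff_torusTier` (ONE vertex-degree vector; cheap cofactor), and the
few-vertices range `NNLowDegreeCofactorHard.nnDivisionHard_of_vertexSupport_budget` (any degree; cofactors
whose monomials touch `≤ s` vertices with `(s+1)·(((log₂ n + c)^c + log₂ n + 1)^6 + 2) ≤ n` are settled).
Since the free top vertex-potential component of a cofactor is no costlier and inherits nothing but its own
vertex data, all four restrictions may be imposed AT ONCE:

* ★ `nnDivisionHard_iff_residualTier` — `NNDivisionHard` ⟺ for every `c`, eventually in `n`, every nonzero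
  `h` that is (i) torus-homogeneous, (ii) of total degree `> 2^⌊n^{1/8}⌋`, (iii) cheap
  (`L₊(h) ≤ 2^((log₂ n + c)^c)`), and (iv) SPREAD — `n < (s+1)·(((log₂ n + c)^c + log₂ n + 1)^6 + 2)` with
  `s` the largest number of vertices touched by a monomial of `h` — satisfies
  `2^((log₂ n + c)^c) < L₊(NN_n · h) + L₊(h)`.

Reading: the open cofactors are torus weight vectors on `Ω(n / polylog n)` vertices with multiplicities
beyond `2^{n^{1/8}}`, computed by repeated squaring in quasi-polynomial size.  Honest framing: bookkeeping
over landed engines (a LOCALISATION), not progress on the crux; `NNDivisionHard`, `NNNotVP`, `VP ≠ VNP`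
remain OPEN (NOT proved).  No definitions, no named facts.
-/

noncomputable section

-- Sub = Summit single-conjunct layout: the duplicated namespace component is mandated by the tree.
set_option linter.dupNamespace false
set_option autoImplicit false

namespace Summit.ValiantsHypothesis.ValiantsHypothesis.Theorems.FifoMatching.NNDivisionHard.TorusHomogeneous

open MvPolynomial Literature.Computability.AlgebraicComplexity
open Summit.ValiantsHypothesis.ValiantsHypothesis.Theorems.ZeroOneTransfer.Negative
open Summit.ValiantsHypothesis.ValiantsHypothesis.Theorems.FifoMatching.NNLowDegreeCofactorHard
  (vertexWeight vertexDeg vertexSupport nnDivisionHard_of_vertexSupport_budget)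
open scoped NNReal

/-- ★ **`NNDivisionHard` ⟺ its residual tier (cheap ∧ torus-homogeneous ∧ hyper-degree ∧ spread).**
[folklore] -/
theorem nnDivisionHard_iff_residualTier :
    Summit.ValiantsHypothesis.ValiantsHypothesis.Theses.FifoMatching.NNDivisionHard ↔
    ∀ c : ℕ, ∃ n₀ : ℕ, ∀ n ≥ n₀, ∀ h : MvPolynomial (Fin (2 * n) × Fin (2 * n)) ℝ≥0, h ≠ 0 →
      (∀ d ∈ h.support, ∀ d' ∈ h.support, vertexDeg d = vertexDeg d') →
      2 ^ Nat.sqrt (Nat.sqrt (Nat.sqrt n)) < h.totalDegree →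
      complexity h ≤ 2 ^ ((Nat.log 2 n + c) ^ c) →
      n < (h.support.sup (fun d => (vertexSupport d).card) + 1) *
          (((Nat.log 2 n + c) ^ c + Nat.log 2 n + 1) ^ 6 + 2) →
        2 ^ ((Nat.log 2 n + c) ^ c) < complexity (nestFreeMatchingPoly n ℝ≥0 * h) + complexity h := by
  constructor
  · intro H c
    obtain ⟨n₀, hn₀⟩ := H c
    exact ⟨n₀, fun n hn h hh _ _ _ _ => hn₀ n hn h hh⟩
  · intro H
    rw [nnDivisionHard_iff_torusTier]
    intro c
    obtain ⟨n₀, hn₀⟩ := H c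
    obtain ⟨n₁, hn₁⟩ := nnDivisionHard_of_vertexSupport_budget c
    refine ⟨max n₀ n₁, fun n hn h hh htor hdeg hcost => ?_⟩
    have hn0 : n₀ ≤ n := le_trans (le_max_left _ _) hn
    have hn1 : n₁ ≤ n := le_trans (le_max_right _ _) hn
    by_cases hb : (h.support.sup (fun d => (vertexSupport d).card) + 1) *
        (((Nat.log 2 n + c) ^ c + Nat.log 2 n + 1) ^ 6 + 2) ≤ n
    · exact hn₁ n hn1 h hh hb
    · exact hn₀ n hn0 h hh htor hdeg hcost (lt_of_not_ge hb)

end Summit.ValiantsHypothesis.ValiantsHypothesis.Theorems.FifoMatching.NNDivisionHard.TorusHomogeneous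

end
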